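import Summits.AtomisticToContinuum.Crystallization.Theorems.ChargedEnergyGapCascadeLoad
import Summits.AtomisticToContinuum.Crystallization.Theorems.ChargedEnergyGapHcpAffineStabilitySym
import HarnessLib

/-!
# ChargedEnergyGap · NODE 69 «StressSplit», part A (lens-3 g69): the material / geometric split of the weighted second variation

Part A of two (400-line cap): §S1 the two bond terms, the two site forms, the summable split and the weighted split (PROVED), §S2 what each form does
to rotations and to affine fields (PROVED), §S3 the two pieces [BAR-ᶜ] / [GEO-ᶜ] and their monotonicity; part B (`ChargedEnergyGapStressSplit`):
§S4 the glue (PROVED) and the sanity instances, §S5 the record cones.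

Line `stmt-AtomisticToContinuum-14231` (`PricedLinkCensus.ChargedEnergyGap`).  Node of record after NODE 68 «CascadeLoad» (critic row 1293):
(H𝄪ᶜ)@rec ⟸ [LOAD-ᶜ] ∧ [COER-ᶜ], `c ∈ {f, h}`; this node splits the STABILITY half [COER-ᶜ](`μ, c_T, cχ, r₁`) = `CoerciveStiffCls`
(`μ·springL − currencies ≤ stiffL` over the twelve-binder hypothesis block of (H𝄪ᶜ), VERBATIM).

THE IDENTITY (the canonical tangent-stiffness decomposition of a prestressed central-force framework — "material + geometric stiffness",
equivalently bar-framework stiffness + stress-matrix form): bond by bond,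
`bondQuad β y z = bondBar β y z + bondGeo β y z`,
`bondBar = (V″(d) − V′(d)/d)·⟪ê, β⟫²` — the BAR (material) term: LONGITUDINAL components only, renormalised spring constants
`c(d) = V″ − V′/d` (`≈ +10.9` on the first shell, `≈ −0.47, −0.12, −0.04, …` beyond: INDEFINITE), ROTATION-BLIND BOND BY BOND like the pivot;
`bondGeo = (V′(d)/d)·‖β‖²` — the GEOMETRIC (prestress) term: ISOTROPIC in the bond vector, coefficients the bond tensions `V′/d` (`≈ −0.24` on the
first shell, `> 0` beyond), whose site sums are governed by the virial: at a SITE-STRESS-FREE site it ANNIHILATES EVERY AFFINE FIELD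
(`geoSite_affineField_empty_eq_zero`: `Σ' (V′/d)‖A r‖² = tr(AᵀA·T_y) = 0`, the kernel property of the stress matrix) and every rotation
(`geoL_rotField_empty`), so its content is purely NON-AFFINE (short-wavelength / optical / edge-of-support).
Hence sitewise `quadSite = barSite + geoSite` under small strain (summability: both terms `≤ 14τ²·coreKernel`, PROVED) and, weighted and excised
exactly like the model, `stiffL = barL + geoL` (`stiffL_eq_barL_add_geoL`, PROVED under `SmallStrain`).

THE SPLIT: [COER-ᶜ](`μ₁ − ν, c′ + c″`) ⟸ [BAR-ᶜ](`μ₁, c′`) ∧ [GEO-ᶜ](`ν, c″`) (glue `coerciveStiffCls_of_bar_of_geo`, part B, PROVED by adding):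
* [BAR-ᶜ](`μ₁, c_T′, cχ′, r₁`) `BarCoerciveCls cls` — **THE RENORMALISED BAR FRAMEWORK IS COERCIVE OVER THE OCTET TRUSS**:
  `μ₁·springL − (c_T′·M_sh + cχ′·M_tr + c_H′·N_pr) ≤ barL`.  A statement about LONGITUDINAL bond components only (no prestress form, no transverse
  components, rotations cost nothing on either side bond by bond): the indefiniteness of the all-pair truss (negative renormalised constants beyond
  the first shell) must be dominated by the first shell through the cocycle structure (a farther bond's elongation is a combination of first-shell
  elongations along lattice paths; octahedron identity `ℓ_diag = (√2/4)(Σ_8 polar − Σ_4 equatorial)`), the excision / weight variation paid in the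
  currencies.  UNDECIDED → TRUE-leaning up to `μ₁ ≈ 1.8` (floats, this memo: Bloch floor `min_k B/S ≈ 1.82` fcc, acoustic shear; `≈ 2.0` hcp) ·
  INSTRUMENTABLE (the census QP with the bar kernel) · ATTACKABLE-M (finite-range truncation + cluster Cauchy–Schwarz; tail `|c(d)| ≲ 8.9·d⁻⁸`).
* [GEO-ᶜ](`ν, c_T″, cχ″, r₁`) `GeoStiffCls cls` — **THE PRESTRESS FORM IS BOUNDED BELOW BY `−ν` TIMES THE OCTET TRUSS**:
  `−ν·springL − (c_T″·M_sh + cχ″·M_tr + c_H″·N_pr) ≤ geoL`.  A statement about the bond TENSIONS only (no `V″`): affine-blind and rotation-blind at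
  site-stress-free sites, it measures the non-affine content of the field against the springs; the negative first-shell tension on transverse /
  optical components must be paid by `ν` times the longitudinal springs of the same field (a transverse component of a cocycle on one bond is
  longitudinal on its neighbours) plus currencies at the support edges.  UNDECIDED → TRUE-leaning for `ν ≳ 0.25` (floats: Bloch ceiling
  `max_k (−G/S) ≈ 0.23` fcc at `k/π ≈ (0.58, 0.58, 0)`, `≈ 0.26` hcp) · INSTRUMENTABLE · ATTACKABLE-M (virial resummation of the isotropic form:
  `Σ_z (V′/d)‖β_yz‖²` against the site virial, class-cut moment tables of NODE 68 §L2 for the odd part).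
NEITHER PIECE CONSUMES `HarmStableModRot μ₀` (answer to critic row 1293): `μ₁` is the bar network's OWN floor and `ν` the prestress form's OWN
ceiling relative to the pivot — the Dirichlet-mod-rotations margin `μ₀ = 1/100` of the block is far too weak to produce either and stays in the
block only so that the pieces remain comparable to (H𝄪ᶜ) binder for binder; a proof of [BAR-ᶜ] may cite a certified Bloch floor as a CERT leaf instead.

TAGS (doctrine).  GENUINE SPLIT by the structure of the potential (second derivative vs. tension), NOT by field components (`β` is never
decomposed; no cross term: the identity is bondwise and exact).  Each piece is STRICTLY WEAKER than [COER-ᶜ] in the doctrine's sense and NEITHER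
IS ITS ANALOGUE (bar: no prestress, longitudinal only; geo: no curvature of `V`, isotropic) — audit MF-1/MF-2: the glue consumes both.  DIFFICULTY
DISTRIBUTED: all-pair truss rigidity (cluster identities, Cauchy–Schwarz) ↔ prestress domination (virial resummation, class-cut odd moments).
COMPOSITION LOSS (the split forbids compensation between the two forms at different wave vectors): `μ^B − (μ₁^B − ν^B) ≈ 1.82 − 1.59 = 0.23`
(fcc floats) — the designate `(μ₁, ν) = (7/4, 1/4)ᶠ, (9/5, 3/10)ʰ` keeps `μ = 3/2` of NODE 68 with THIN margins (`4 %, 8 %` fcc); the record cone is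
PARAMETRIC and the census decides (ASKs STAB-69B / STAB-69G; kill: `μ₁^B − ν^B < 6/5` at a record reference).

0 sorry · 0 native_decide · no private / instance / notation · standard axioms (audit file `check/AuditSS69.lean` over the tower Sym ++ A ++ B).
-/

noncomputable section
open scoped Classical
open Literature.MathematicalPhysics.StatisticalMechanics Literature.Geometry.DiscreteGeometry
open Summit.AtomisticToContinuum.Crystallization.Theses.PricedLinkCensus
open Summit.AtomisticToContinuum.Crystallization.Theorems.ChargedEnergyGapNegative

namespace Summit.AtomisticToContinuum.Crystallization.Theorems.ChargedEnergyGapChartDial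

/-! ## §S1 The bar and geometric bond terms, the two site forms, the split (PROVED) -/

section Forms

variable (β : E3 → E3 → E3) (P : PeriodicConfiguration 3) (X : Set E3)

/-- The **BAR (material) bond term** `(V″(d) − V′(d)/d)·⟪ê_yz, β y z⟫²` — renormalised longitudinal spring. -/
def bondBar (β : E3 → E3 → E3) (y z : E3) : ℝ :=
  (ljD2 (dist y z) - ljD1 (dist y z) / dist y z) * inner ℝ ((dist y z)⁻¹ • (z - y)) (β y z) ^ 2

/-- The **GEOMETRIC (prestress) bond term** `(V′(d)/d)·‖β y z‖²` — bond tension times the full squared jump. -/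
def bondGeo (β : E3 → E3 → E3) (y z : E3) : ℝ :=
  ljD1 (dist y z) / dist y z * ‖β y z‖ ^ 2

/-- ★ THE BONDWISE IDENTITY: second variation = bar + geometric. -/
theorem bondQuad_eq_bondBar_add_bondGeo (y z : E3) : bondQuad β y z = bondBar β y z + bondGeo β y z := by
  unfold bondQuad bondBar bondGeo
  ring

/-- The bar term is BLIND TO ROTATIONS bond by bond (no longitudinal component, `inner_unit_rotField`) … -/
theorem bondBar_rotField (r₀ v y z : E3) : bondBar (rotField r₀ v) y z = 0 := by
  simp [bondBar, inner_unit_rotField]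

/-- … so on a rotation cocycle the whole second variation is geometric. -/
theorem bondGeo_rotField (r₀ v y z : E3) : bondGeo (rotField r₀ v) y z = bondQuad (rotField r₀ v) y z := by
  rw [bondQuad_eq_bondBar_add_bondGeo, bondBar_rotField, zero_add]

/-- The **BAR SITE FORM** `¼·Σ'_{z ∈ P ∖ X, z ≠ y} bondBar β y z` (excised like `quadSite`). -/
def barSite (y : E3) : ℝ :=
  (1 / 4) * ∑' z : {z : E3 // z ∈ P.points ∧ z ∉ X ∧ z ≠ y}, bondBar β y (z : E3)

/-- The **GEOMETRIC (prestress) SITE FORM** `¼·Σ'_{z ∈ P ∖ X, z ≠ y} bondGeo β y z`. -/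
def geoSite (y : E3) : ℝ :=
  (1 / 4) * ∑' z : {z : E3 // z ∈ P.points ∧ z ∉ X ∧ z ≠ y}, bondGeo β y (z : E3)

/-- The bar site form of a rotation cocycle vanishes (every reference, every excision) … -/
theorem barSite_rotField (r₀ v y : E3) : barSite (rotField r₀ v) P X y = 0 := by
  simp [barSite, bondBar_rotField]

/-- … and its geometric site form is the whole second variation. -/
theorem geoSite_rotField (r₀ v y : E3) : geoSite (rotField r₀ v) P X y = quadSite (rotField r₀ v) P X y := by
  unfold geoSite quadSite
  congr 1
  exact tsum_congr fun z => bondGeo_rotField r₀ v y z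

variable {β}

/-- Pointwise bound: on a bond with `‖β‖ ≤ τ·d` the bar term is at most `14τ²·(d⁻¹² + d⁻⁶)`. -/
theorem abs_bondBar_le {τ : ℝ} {y z : E3} (hd : 0 < dist y z) (hβ : ‖β y z‖ ≤ τ * dist y z) :
    |bondBar β y z| ≤ 14 * τ ^ 2 * coreKernel (dist y z) := by
  unfold bondBar coreKernel
  set d := dist y z with hd_def
  have hx : ‖z - y‖ = d := by rw [hd_def, dist_eq_norm, norm_sub_rev]
  set q := inner ℝ (d⁻¹ • (z - y)) (β y z) with hq
  have hqw : |q| ≤ ‖β y z‖ := by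
    calc |q| ≤ ‖d⁻¹ • (z - y)‖ * ‖β y z‖ := abs_real_inner_le_norm _ _
      _ = ‖β y z‖ := by rw [norm_smul, Real.norm_eq_abs, abs_of_pos (inv_pos.2 hd), hx, inv_mul_cancel₀ hd.ne', one_mul]
  have hq2 : q ^ 2 ≤ (τ * d) ^ 2 := by
    rw [← sq_abs q]
    exact pow_le_pow_left₀ (abs_nonneg q) (hqw.trans hβ) 2
  have hc : |ljD2 d - ljD1 d / d| ≤ 13 * d⁻¹ ^ 14 + 7 * d⁻¹ ^ 8 + (d⁻¹ ^ 13 + d⁻¹ ^ 7) / d := by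
    refine (abs_sub _ _).trans (add_le_add (abs_ljD2_le hd) ?_)
    rw [abs_div, abs_of_pos hd]
    exact div_le_div_of_nonneg_right (abs_ljD1_le d hd) hd.le
  have hdi : d⁻¹ * d = 1 := inv_mul_cancel₀ hd.ne'
  rw [abs_mul, abs_of_nonneg (sq_nonneg q)]
  calc |ljD2 d - ljD1 d / d| * q ^ 2 ≤ (13 * d⁻¹ ^ 14 + 7 * d⁻¹ ^ 8 + (d⁻¹ ^ 13 + d⁻¹ ^ 7) / d) * (τ * d) ^ 2 :=
        mul_le_mul hc hq2 (sq_nonneg q) (by positivity)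
    _ = τ ^ 2 * (14 * d⁻¹ ^ 12 + 8 * d⁻¹ ^ 6) * (d⁻¹ * d) ^ 2 := by
        rw [div_eq_mul_inv]
        ring
    _ = τ ^ 2 * (14 * d⁻¹ ^ 12 + 8 * d⁻¹ ^ 6) := by rw [hdi, one_pow, mul_one]
    _ ≤ 14 * τ ^ 2 * (d⁻¹ ^ 12 + d⁻¹ ^ 6) := by nlinarith [sq_nonneg τ, pow_pos (inv_pos.2 hd) 6, pow_pos (inv_pos.2 hd) 12]

/-- Pointwise bound: on a bond with `‖β‖ ≤ τ·d` the geometric term is at most `τ²·(d⁻¹² + d⁻⁶)`. -/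
theorem abs_bondGeo_le {τ : ℝ} {y z : E3} (hd : 0 < dist y z) (hβ : ‖β y z‖ ≤ τ * dist y z) :
    |bondGeo β y z| ≤ τ ^ 2 * coreKernel (dist y z) := by
  unfold bondGeo coreKernel
  set d := dist y z with hd_def
  have hw2 : ‖β y z‖ ^ 2 ≤ (τ * d) ^ 2 := pow_le_pow_left₀ (norm_nonneg _) hβ 2
  have hdi : d⁻¹ * d = 1 := inv_mul_cancel₀ hd.ne'
  rw [abs_mul, abs_div, abs_of_pos hd, abs_of_nonneg (sq_nonneg ‖β y z‖)]
  calc |ljD1 d| / d * ‖β y z‖ ^ 2 ≤ (d⁻¹ ^ 13 + d⁻¹ ^ 7) / d * (τ * d) ^ 2 :=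
        mul_le_mul (div_le_div_of_nonneg_right (abs_ljD1_le d hd) hd.le) hw2 (sq_nonneg _) (by positivity)
    _ = τ ^ 2 * (d⁻¹ ^ 12 + d⁻¹ ^ 6) * (d⁻¹ * d) ^ 2 := by
        rw [div_eq_mul_inv]
        ring
    _ = τ ^ 2 * (d⁻¹ ^ 12 + d⁻¹ ^ 6) := by rw [hdi, one_pow, mul_one]

/-- The core kernel is summable over the EXCISED bonds at `y` (a sub-family of `summable_coreKernel`). -/
theorem summable_coreKernel_excised (y : E3) :
    Summable fun z : {z : E3 // z ∈ P.points ∧ z ∉ X ∧ z ≠ y} => coreKernel (dist y (z : E3)) :=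
  ((summable_coreKernel P y).comp_injective
    (i := fun z : {z : E3 // z ∈ P.points ∧ z ∉ X ∧ z ≠ y} => (⟨(z : E3), z.2.1, z.2.2.2⟩ : {z : E3 // z ∈ P.points ∧ z ≠ y}))
    (fun a b hab => Subtype.ext (by simpa using congrArg Subtype.val hab))).congr fun _ => rfl

variable {P X}

/-- Under a small-strain bound on the excised bonds at `y` the bar terms are summable … -/
theorem summable_bondBar {τ : ℝ} {y : E3} (hβ : ∀ z : E3, z ∈ P.points → z ∉ X → z ≠ y → ‖β y z‖ ≤ τ * dist y z) :
    Summable fun z : {z : E3 // z ∈ P.points ∧ z ∉ X ∧ z ≠ y} => bondBar β y (z : E3) := by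
  refine Summable.of_norm_bounded ((summable_coreKernel_excised P X y).mul_left (14 * τ ^ 2)) fun z => ?_
  rw [Real.norm_eq_abs]
  exact abs_bondBar_le (dist_pos.2 fun h => z.2.2.2 h.symm) (hβ z z.2.1 z.2.2.1 z.2.2.2)

/-- … and so are the geometric terms. -/
theorem summable_bondGeo {τ : ℝ} {y : E3} (hβ : ∀ z : E3, z ∈ P.points → z ∉ X → z ≠ y → ‖β y z‖ ≤ τ * dist y z) :
    Summable fun z : {z : E3 // z ∈ P.points ∧ z ∉ X ∧ z ≠ y} => bondGeo β y (z : E3) := by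
  refine Summable.of_norm_bounded ((summable_coreKernel_excised P X y).mul_left (τ ^ 2)) fun z => ?_
  rw [Real.norm_eq_abs]
  exact abs_bondGeo_le (dist_pos.2 fun h => z.2.2.2 h.symm) (hβ z z.2.1 z.2.2.1 z.2.2.2)

/-- ★ THE SITEWISE SPLIT (PROVED): under a small-strain bound on the excised bonds at `y`, `quadSite = barSite + geoSite`. -/
theorem quadSite_eq_barSite_add_geoSite {τ : ℝ} {y : E3}
    (hβ : ∀ z : E3, z ∈ P.points → z ∉ X → z ≠ y → ‖β y z‖ ≤ τ * dist y z) :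
    quadSite β P X y = barSite β P X y + geoSite β P X y := by
  unfold quadSite barSite geoSite
  rw [← mul_add, ← (summable_bondBar hβ).tsum_add (summable_bondGeo hβ)]
  congr 1
  exact tsum_congr fun z => bondQuad_eq_bondBar_add_bondGeo β y z

/-- Bond sums over the EMPTY excision are bond sums over all points (reindexing, no summability needed). -/
theorem tsum_excised_empty (P : PeriodicConfiguration 3) (f : E3 → ℝ) (y : E3) :
    ∑' z : {z : E3 // z ∈ P.points ∧ z ∉ (∅ : Set E3) ∧ z ≠ y}, f (z : E3) = ∑' z : {z : E3 // z ∈ P.points ∧ z ≠ y}, f (z : E3) := by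
  let e : {z : E3 // z ∈ P.points ∧ z ∉ (∅ : Set E3) ∧ z ≠ y} ≃ {z : E3 // z ∈ P.points ∧ z ≠ y} :=
    Equiv.subtypeEquivRight fun z => by simp
  rw [← e.symm.tsum_eq]
  rfl

variable (ϱχ : ℝ) {m : ℕ} (D : Fin m → Set E3) (σ : Fin m → Bool)

/-- The **WEIGHTED EXCISED BAR FORM** `Σ_{y ∈ motif ∖ X} χ(y)·w(y)·barSite_y(β)` — weighted and excised exactly like `stiffL`. -/
def barL (β : E3 → E3 → E3) (P : PeriodicConfiguration 3) (X : Set E3) (ϱ : ℝ) (C : Set E3) : ℝ :=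
  ∑ y ∈ P.motif, if y ∈ X then 0 else localFactor ϱχ D σ y * (profileWeight ϱ C y * barSite β P X y)

/-- The **WEIGHTED EXCISED PRESTRESS FORM** `Σ_{y ∈ motif ∖ X} χ(y)·w(y)·geoSite_y(β)`. -/
def geoL (β : E3 → E3 → E3) (P : PeriodicConfiguration 3) (X : Set E3) (ϱ : ℝ) (C : Set E3) : ℝ :=
  ∑ y ∈ P.motif, if y ∈ X then 0 else localFactor ϱχ D σ y * (profileWeight ϱ C y * geoSite β P X y)

variable {ϱχ D σ}

/-- ★ THE WEIGHTED SPLIT (PROVED): under `SmallStrain τ P X β`, `stiffL = barL + geoL`. -/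
theorem stiffL_eq_barL_add_geoL {τ : ℝ} (hτ : SmallStrain τ P X β) (ϱ : ℝ) (C : Set E3) :
    stiffL ϱχ D σ β P X ϱ C = barL ϱχ D σ β P X ϱ C + geoL ϱχ D σ β P X ϱ C := by
  unfold stiffL barL geoL
  rw [← Finset.sum_add_distrib]
  refine Finset.sum_congr rfl fun y hy => ?_
  split_ifs with hyX
  · simp
  · rw [quadSite_eq_barSite_add_geoSite (τ := τ) fun z hz hzX _ => hτ y (P.mem_points_of_mem_motif hy) z hz hyX hzX]
    ring

/-- The weighted bar form of a rotation cocycle vanishes (every reference, EVERY excision) … -/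
theorem barL_rotField (ϱ : ℝ) (C : Set E3) (r₀ v : E3) : barL ϱχ D σ (rotField r₀ v) P X ϱ C = 0 := by
  simp [barL, barSite_rotField]

/-- … its weighted prestress form is its whole weighted second variation … -/
theorem geoL_rotField (ϱ : ℝ) (C : Set E3) (r₀ v : E3) :
    geoL ϱχ D σ (rotField r₀ v) P X ϱ C = stiffL ϱχ D σ (rotField r₀ v) P X ϱ C := by
  simp [geoL, stiffL, geoSite_rotField]

/-- … which vanishes at a SITE-stress-free reference without excision (`stiffL_rotField_empty`). -/
theorem geoL_rotField_empty (hS : IsSiteStressFree P) (ϱ : ℝ) (C : Set E3) (r₀ v : E3) :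
    geoL ϱχ D σ (rotField r₀ v) P ∅ ϱ C = 0 := by
  rw [geoL_rotField, stiffL_rotField_empty hS]

end Forms

/-! ## §S2 The prestress form is AFFINE-BLIND at site-stress-free sites (the kernel property of the stress matrix, PROVED) -/

section AffineBlind

variable {P : PeriodicConfiguration 3} {y : E3}

/-- ★ **THE PRESTRESS FORM ANNIHILATES EVERY AFFINE FIELD at a site with vanishing site virial**:
`geoSite (affineField A) P ∅ y = ¼·Σ' (V′/d)·⟪r, AᵀA r⟫ = 0` (`tsum_virial_quadForm_eq_zero` with `B := Aᵀ ∘ A`). -/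
theorem geoSite_affineField_empty_eq_zero (hV : ∀ a b : E3, siteVirial P y a b = 0) (A : E3 →ₗ[ℝ] E3) :
    geoSite (affineField A) P ∅ y = 0 := by
  unfold geoSite
  rw [tsum_excised_empty P (fun z => bondGeo (affineField A) y z) y]
  have e : ∀ z : E3, bondGeo (affineField A) y z =
      ljD1 (dist y z) / dist y z * inner ℝ (z - y) ((LinearMap.adjoint A ∘ₗ A) (z - y)) := by
    intro z
    simp only [bondGeo, affineField_apply, LinearMap.comp_apply, LinearMap.adjoint_inner_right, real_inner_self_eq_norm_sq]
  simp_rw [e]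
  rw [tsum_virial_quadForm_eq_zero hV (LinearMap.adjoint A ∘ₗ A), mul_zero]

/-- … hence at such a site the bar form of an affine field IS its whole second variation: the sitewise affine stability inequalities
([A-i], `κ·⟪u, A u⟫² ≤ quadSite (affineField A) P ∅ y`) are statements about the BAR form. -/
theorem barSite_affineField_empty_eq (hV : ∀ a b : E3, siteVirial P y a b = 0) (A : E3 →ₗ[ℝ] E3) :
    barSite (affineField A) P ∅ y = quadSite (affineField A) P ∅ y := by
  have hA : ∀ z : E3, z ∈ P.points → z ∉ (∅ : Set E3) → z ≠ y →
      ‖affineField A y z‖ ≤ ‖LinearMap.toContinuousLinearMap A‖ * dist y z := by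
    intro z _ _ _
    rw [affineField_apply, dist_eq_norm, norm_sub_rev y z]
    exact (LinearMap.toContinuousLinearMap A).le_opNorm (z - y)
  rw [quadSite_eq_barSite_add_geoSite hA, geoSite_affineField_empty_eq_zero hV A, add_zero]

/-- The weighted prestress form of an affine field vanishes at a SITE-stress-free reference without excision. -/
theorem geoL_affineField_empty (hS : IsSiteStressFree P) (ϱχ : ℝ) {m : ℕ} (D : Fin m → Set E3) (σ : Fin m → Bool) (ϱ : ℝ)
    (C : Set E3) (A : E3 →ₗ[ℝ] E3) : geoL ϱχ D σ (affineField A) P ∅ ϱ C = 0 :=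
  Finset.sum_eq_zero fun y hy => by
    simp [geoSite_affineField_empty_eq_zero (hS.siteVirial_eq_zero (P.mem_points_of_mem_motif hy)) A]

end AffineBlind

/-! ## §S3 The two pieces -/

section Pieces

variable (cls : Set E3 → Prop) (s lam ℓ μ₀ τ ϱ b₀ r_S ϱχ r₁ : ℝ)

/-- ★ piece [BAR-ᶜ](`μ₁, c_T, cχ, r₁`) · **THE RENORMALISED BAR FRAMEWORK IS COERCIVE OVER THE PIVOT**: over the hypothesis block of (H𝄪ᶜ)
VERBATIM, `μ₁·springL(β) − (c_T·M_sh + cχ·M_tr + c_H·N_pr) ≤ barL(β)` for the Volterra field `β` of the data (dials `(s, λ_lab, ℓ, μ₀, τ, ϱ, b₀, r_S,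
ϱχ, r₁ ; μ₁, c_T, cχ)`, the order of `CoerciveStiffCls`).  Longitudinal components only; no prestress form.  UNDECIDED → TRUE-leaning up to
`μ₁ ≈ 1.8` · INSTRUMENTABLE · ATTACKABLE-M.  Why it might fail: the acoustic shear floor of the bar network (`min B/S ≈ 1.82·springs`, fcc floats) lying
below the designate `7/4` once weights and excision are in (edge-of-support concentration), or the negative renormalised constants of shells 2–5
(`−0.47, −0.12, −0.04, −0.02` × multiplicities `6, 24, 12, 24`) not being dominated cluster by cluster with the currencies at `(1/(30·10⁶), 10⁻⁶)`. -/
def BarCoerciveCls (μ₁ c_T cχ : ℝ) : Prop :=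
  ∃ c_H : ℝ, 0 ≤ c_H ∧ ∀ (P : PeriodicConfiguration 3) (C X : Set E3) (β₀ : E3 → E3 → E3) (k : ℕ) (S : Fin k → CutPiece)
    (m : ℕ) (D : Fin m → Set E3) (σ : Fin m → Bool),
    IsSeparatedRef s P → IsLabelledRef lam ℓ P → cls P.points → IsForceFree P → IsSiteStressFree P → HarmStableModRot μ₀ P →
    IsInvariantSet P C → IsInvariantSet P X → IsGlobalCocycle P β₀ → IsSeamSystem b₀ r_S P S →
    SmallStrain τ P X (volterraField P S β₀) → (∀ i, IsInvariantSet P (D i)) →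
      μ₁ * springL ϱχ D σ (volterraField P S β₀) P X r₁ ϱ C - c_T * shellMassL ϱχ D σ P X ϱ C - cχ * transMassL ϱχ D σ P X ϱ C -
          c_H * (pricedNearCountL ϱχ D σ P X ϱ C : ℝ) ≤
        barL ϱχ D σ (volterraField P S β₀) P X ϱ C

/-- ★ piece [GEO-ᶜ](`ν, c_T, cχ, r₁`) · **THE PRESTRESS FORM IS BOUNDED BELOW BY `−ν` TIMES THE PIVOT**: over the hypothesis block of (H𝄪ᶜ)
VERBATIM, `−ν·springL(β) − (c_T·M_sh + cχ·M_tr + c_H·N_pr) ≤ geoL(β)` (dials as [BAR-ᶜ] with `ν` for `μ₁`).  Bond tensions only; affine-blind and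
rotation-blind at site-stress-free sites.  UNDECIDED → TRUE-leaning for `ν ≳ 0.25` · INSTRUMENTABLE · ATTACKABLE-M.  Why it might fail: a
zone-boundary (fcc `k/π ≈ (0.58, 0.58, 0)`, `max −G/S ≈ 0.23`) or optical (hcp, `≈ 0.26`) periodic field exceeding the designate `ν` once weights and
excision are in — first-shell tension `V′/d ≈ −0.24` on transverse components concentrated where `χ·w` varies fastest, beyond the currencies. -/
def GeoStiffCls (ν c_T cχ : ℝ) : Prop :=
  ∃ c_H : ℝ, 0 ≤ c_H ∧ ∀ (P : PeriodicConfiguration 3) (C X : Set E3) (β₀ : E3 → E3 → E3) (k : ℕ) (S : Fin k → CutPiece)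
    (m : ℕ) (D : Fin m → Set E3) (σ : Fin m → Bool),
    IsSeparatedRef s P → IsLabelledRef lam ℓ P → cls P.points → IsForceFree P → IsSiteStressFree P → HarmStableModRot μ₀ P →
    IsInvariantSet P C → IsInvariantSet P X → IsGlobalCocycle P β₀ → IsSeamSystem b₀ r_S P S →
    SmallStrain τ P X (volterraField P S β₀) → (∀ i, IsInvariantSet P (D i)) →
      -(ν * springL ϱχ D σ (volterraField P S β₀) P X r₁ ϱ C) - c_T * shellMassL ϱχ D σ P X ϱ C - cχ * transMassL ϱχ D σ P X ϱ C -
          c_H * (pricedNearCountL ϱχ D σ P X ϱ C : ℝ) ≤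
        geoL ϱχ D σ (volterraField P S β₀) P X ϱ C

variable {cls s lam ℓ μ₀ τ ϱ b₀ r_S ϱχ r₁}

/-- [BAR-ᶜ] is antitone in the modulus `μ₁` and monotone in both losses. -/
theorem BarCoerciveCls.mono {μ₁ μ₁' c_T c_T' cχ cχ' : ℝ} (hμ : μ₁' ≤ μ₁) (hc : c_T ≤ c_T') (hχ : cχ ≤ cχ')
    (h : BarCoerciveCls cls s lam ℓ μ₀ τ ϱ b₀ r_S ϱχ r₁ μ₁ c_T cχ) : BarCoerciveCls cls s lam ℓ μ₀ τ ϱ b₀ r_S ϱχ r₁ μ₁' c_T' cχ' := by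
  obtain ⟨c_H, hH, h⟩ := h
  refine ⟨c_H, hH, fun P C X β₀ k S m D σ h1 h2 hb h3 h4 h5 h6 h7 h8 h9 h10 h11 => ?_⟩
  have H := h P C X β₀ k S m D σ h1 h2 hb h3 h4 h5 h6 h7 h8 h9 h10 h11
  have hM := shellMassL_nonneg (ϱχ := ϱχ) (D := D) (σ := σ) P X ϱ C
  have hT' := transMassL_nonneg (ϱχ := ϱχ) (D := D) (σ := σ) P X ϱ C
  have hS := springL_nonneg (volterraField P S β₀) P X r₁ (ϱχ := ϱχ) (D := D) (σ := σ) ϱ C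
  nlinarith [mul_le_mul_of_nonneg_right hc hM, mul_le_mul_of_nonneg_right hχ hT', mul_le_mul_of_nonneg_right hμ hS]

/-- [GEO-ᶜ] is monotone in `ν` (a larger `ν` is a weaker claim: the pivot is non-negative) and in both losses. -/
theorem GeoStiffCls.mono {ν ν' c_T c_T' cχ cχ' : ℝ} (hν : ν ≤ ν') (hc : c_T ≤ c_T') (hχ : cχ ≤ cχ')
    (h : GeoStiffCls cls s lam ℓ μ₀ τ ϱ b₀ r_S ϱχ r₁ ν c_T cχ) : GeoStiffCls cls s lam ℓ μ₀ τ ϱ b₀ r_S ϱχ r₁ ν' c_T' cχ' := by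
  obtain ⟨c_H, hH, h⟩ := h
  refine ⟨c_H, hH, fun P C X β₀ k S m D σ h1 h2 hb h3 h4 h5 h6 h7 h8 h9 h10 h11 => ?_⟩
  have H := h P C X β₀ k S m D σ h1 h2 hb h3 h4 h5 h6 h7 h8 h9 h10 h11
  have hM := shellMassL_nonneg (ϱχ := ϱχ) (D := D) (σ := σ) P X ϱ C
  have hT' := transMassL_nonneg (ϱχ := ϱχ) (D := D) (σ := σ) P X ϱ C
  have hS := springL_nonneg (volterraField P S β₀) P X r₁ (ϱχ := ϱχ) (D := D) (σ := σ) ϱ C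
  nlinarith [mul_le_mul_of_nonneg_right hc hM, mul_le_mul_of_nonneg_right hχ hT', mul_le_mul_of_nonneg_right hν hS]

end Pieces

end Summit.AtomisticToContinuum.Crystallization.Theorems.ChargedEnergyGapChartDial
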